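import Summits.Ventures.HSemireg.EdgeLeadingDigit

/-!
# Parity of Pfaffians against a sum of basis 4-vectors; congruent 2-forms (pub-hsemireg, S4-PUSH corner 2)

Kernel leg of seat s4-search-2 gen 17 (cell `pub-hsemireg`), ROW W; generic tools for the CLIQUE units of ROW L2
(`CliqueUnitsClassDead`), where CRITERION L at `k = 2` reads `B·B ≡ 2·P₂ (mod 4Λ)` with `P₂ = Σ_{s<s'} h_s h_{s'}`
a SUM of slot-pair 4-vectors (the divided square of the clique sum `P₁`).
* `kill_fourVec` — the functional of `EdgeDigitSupport.exists_coeffFunctional` kills the 4-vector of any quadruple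
  with a coordinate outside `{i, j, k, l}`.
* `pfaffian_parity_of_sq_sum` — if `B·B = 2·Ω + 4W` with `Ω = Σ_{u ∈ L} ι x_{u₀} ι x_{u₁} · ι x_{u₂} ι x_{u₃}` and every
  `u ∈ L` is `(i, j, k, l)` itself or has a coordinate outside, then `Pf_{ijkl}(c) ≡ #{u ∈ L : u = (i,j,k,l)} (mod 2)`;
  `pfaffian_even_of_sq_sum` ∕ `pfaffian_odd_of_sq_sum` — the two cases, with the side conditions as Boolean
  `List.all` tests (decided by `decide` on concrete lists).
* `twoForm_congr_mod_two` — entrywise congruent coefficient arrays give 2-forms congruent modulo `2·span`.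
The `K₄` ∕ `K₃` clique digits are `CliqueFourDigit.lean` ∕ `CliqueThreeDigit.lean`; the compositions with ROW L2
are `CliqueEveryDigit.lean` (ROW X).

Scope ∕ honest framing: multilinear algebra over `ℤ` (count-neutral, theorems only, no `def`); CRITERION L as the
registered necessary condition, the signature table and the census remain framework words; no object, no `σ`
computation, no Hodge statement; nothing here bears on HC ∕ HC_CM ∕ HC_AV.
-/

namespace Summit.Ventures.HSemireg.CliqueDigitSupport

open ExteriorAlgebra DecomposableTwoForms DividedSquareParity EdgeDigitSupport EdgeLeadingDigit

section Parity

variable {M : Type*} [AddCommGroup M] [Module ℤ M] {n : Type*} [LinearOrder n] [Fintype n]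

omit [LinearOrder n] [Fintype n] in
/-- A functional killing every product through a generator outside `{i, j, k, l}` kills the 4-vector of any
quadruple with a coordinate outside. -/
theorem kill_fourVec (x : n → M) {i j k l : n} (Φ : ExteriorAlgebra ℤ M →ₗ[ℤ] ℤ)
    (hkill : ∀ a, a ≠ i → a ≠ j → a ≠ k → a ≠ l → ∀ Y Y' : ExteriorAlgebra ℤ M, Φ (Y * ι ℤ (x a) * Y') = 0)
    (u : n × n × n × n)
    (hu : (u.1 ≠ i ∧ u.1 ≠ j ∧ u.1 ≠ k ∧ u.1 ≠ l) ∨ (u.2.1 ≠ i ∧ u.2.1 ≠ j ∧ u.2.1 ≠ k ∧ u.2.1 ≠ l) ∨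
      (u.2.2.1 ≠ i ∧ u.2.2.1 ≠ j ∧ u.2.2.1 ≠ k ∧ u.2.2.1 ≠ l) ∨
      (u.2.2.2 ≠ i ∧ u.2.2.2 ≠ j ∧ u.2.2.2 ≠ k ∧ u.2.2.2 ≠ l)) :
    Φ (ι ℤ (x u.1) * ι ℤ (x u.2.1) * (ι ℤ (x u.2.2.1) * ι ℤ (x u.2.2.2))) = 0 := by
  rcases hu with ⟨h1, h2, h3, h4⟩ | ⟨h1, h2, h3, h4⟩ | ⟨h1, h2, h3, h4⟩ | ⟨h1, h2, h3, h4⟩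
  · simpa [mul_assoc] using hkill _ h1 h2 h3 h4 1 (ι ℤ (x u.2.1) * (ι ℤ (x u.2.2.1) * ι ℤ (x u.2.2.2)))
  · simpa [mul_assoc] using hkill _ h1 h2 h3 h4 (ι ℤ (x u.1)) (ι ℤ (x u.2.2.1) * ι ℤ (x u.2.2.2))
  · simpa [mul_assoc] using hkill _ h1 h2 h3 h4 (ι ℤ (x u.1) * ι ℤ (x u.2.1)) (ι ℤ (x u.2.2.2))
  · simpa [mul_assoc] using hkill _ h1 h2 h3 h4 (ι ℤ (x u.1) * ι ℤ (x u.2.1) * ι ℤ (x u.2.2.1)) 1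

/-- **Parity of the Pfaffians when `B·B ≡ 2·Ω (mod 4Λ)` for a sum `Ω` of basis 4-vectors.**  Let `L` be a list of
quadruples and `Ω = Σ_{u ∈ L} ι x_{u₀} ι x_{u₁} · ι x_{u₂} ι x_{u₃}`.  If `B·B = 2·Ω + 4W`, and `i, j, k, l` are pairwise
distinct indices such that every `u ∈ L` is either `(i, j, k, l)` itself or has a coordinate outside `{i, j, k, l}`,
then `Pf_{ijkl}(c) ≡ #{u ∈ L : u = (i,j,k,l)} (mod 2)`. -/
theorem pfaffian_parity_of_sq_sum (x : Module.Basis n ℤ M) (c : n → n → ℤ) (h0 : ∀ a, c a a = 0)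
    (hskew : ∀ a b, c b a = -c a b) (B W : ExteriorAlgebra ℤ M)
    (hB : B = ∑ a, ∑ b, if a < b then (c a b : ExteriorAlgebra ℤ M) * (ι ℤ (x a) * ι ℤ (x b)) else 0)
    (L : List (n × n × n × n))
    (hBB : B * B = 2 * (L.map fun u => ι ℤ (x u.1) * ι ℤ (x u.2.1) * (ι ℤ (x u.2.2.1) * ι ℤ (x u.2.2.2))).sum
      + 4 * W)
    {i j k l : n} (hij : i ≠ j) (hik : i ≠ k) (hil : i ≠ l) (hjk : j ≠ k) (hjl : j ≠ l) (hkl : k ≠ l)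
    (hL : ∀ u ∈ L, u = (i, j, k, l) ∨ ((u.1 ≠ i ∧ u.1 ≠ j ∧ u.1 ≠ k ∧ u.1 ≠ l) ∨
      (u.2.1 ≠ i ∧ u.2.1 ≠ j ∧ u.2.1 ≠ k ∧ u.2.1 ≠ l) ∨ (u.2.2.1 ≠ i ∧ u.2.2.1 ≠ j ∧ u.2.2.1 ≠ k ∧ u.2.2.1 ≠ l) ∨
      (u.2.2.2 ≠ i ∧ u.2.2.2 ≠ j ∧ u.2.2.2 ≠ k ∧ u.2.2.2 ≠ l))) :
    ((c i j * c k l - c i k * c j l + c i l * c j k : ℤ) : ZMod 2) = (L.count (i, j, k, l) : ZMod 2) := by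
  classical
  obtain ⟨Φ, h1, hkill, hnum, hsq⟩ := exists_coeffFunctional x hij hik hil hjk hjl hkl
  -- `Φ(Ω) = count`
  have hΩ : ∀ L' : List (n × n × n × n), (∀ u ∈ L', u = (i, j, k, l) ∨ ((u.1 ≠ i ∧ u.1 ≠ j ∧ u.1 ≠ k ∧ u.1 ≠ l) ∨
      (u.2.1 ≠ i ∧ u.2.1 ≠ j ∧ u.2.1 ≠ k ∧ u.2.1 ≠ l) ∨ (u.2.2.1 ≠ i ∧ u.2.2.1 ≠ j ∧ u.2.2.1 ≠ k ∧ u.2.2.1 ≠ l) ∨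
      (u.2.2.2 ≠ i ∧ u.2.2.2 ≠ j ∧ u.2.2.2 ≠ k ∧ u.2.2.2 ≠ l))) →
      Φ (L'.map fun u => ι ℤ (x u.1) * ι ℤ (x u.2.1) * (ι ℤ (x u.2.2.1) * ι ℤ (x u.2.2.2))).sum
        = (L'.count (i, j, k, l) : ℤ) := by
    intro L' hL'
    induction L' with
    | nil => simp
    | cons u L' ih =>
      rw [List.map_cons, List.sum_cons, map_add, ih (fun v hv => hL' v (List.mem_cons_of_mem _ hv)),
        List.count_cons]
      rcases hL' u List.mem_cons_self with rfl | hu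
      · simp [h1, add_comm]
      · have hne : ¬ (u = (i, j, k, l)) := by
          rintro rfl
          rcases hu with ⟨h, -, -, -⟩ | ⟨-, h, -, -⟩ | ⟨-, -, h, -⟩ | ⟨-, -, -, h⟩ <;> exact h rfl
        rw [kill_fourVec x Φ hkill u hu]
        simp [hne, beq_iff_eq]
  have key := hsq c h0 hskew
  rw [← hB, hBB, map_add, hnum 2, hnum 4, hΩ L hL] at key
  have k' : (2 : ℤ) * (L.count (i, j, k, l) : ℤ) + 4 * Φ W
      = 2 * (c i j * c k l - c i k * c j l + c i l * c j k) := key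
  have k'' : (c i j * c k l - c i k * c j l + c i l * c j k : ℤ) = (L.count (i, j, k, l) : ℤ) + 2 * Φ W := by
    linarith
  rw [k'']
  push_cast
  rw [show (2 : ZMod 2) = 0 from rfl]
  ring

/-- Even case of `pfaffian_parity_of_sq_sum`: every 4-vector of `Ω` has a coordinate outside `{i, j, k, l}`. -/
theorem pfaffian_even_of_sq_sum (x : Module.Basis n ℤ M) (c : n → n → ℤ) (h0 : ∀ a, c a a = 0)
    (hskew : ∀ a b, c b a = -c a b) (B W : ExteriorAlgebra ℤ M)
    (hB : B = ∑ a, ∑ b, if a < b then (c a b : ExteriorAlgebra ℤ M) * (ι ℤ (x a) * ι ℤ (x b)) else 0)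
    (L : List (n × n × n × n))
    (hBB : B * B = 2 * (L.map fun u => ι ℤ (x u.1) * ι ℤ (x u.2.1) * (ι ℤ (x u.2.2.1) * ι ℤ (x u.2.2.2))).sum
      + 4 * W)
    {i j k l : n} (hij : i ≠ j) (hik : i ≠ k) (hil : i ≠ l) (hjk : j ≠ k) (hjl : j ≠ l) (hkl : k ≠ l)
    (hL : (L.all fun u => (u.1 != i && u.1 != j && u.1 != k && u.1 != l) || (u.2.1 != i && u.2.1 != j && u.2.1 != k && u.2.1 != l)
      || (u.2.2.1 != i && u.2.2.1 != j && u.2.2.1 != k && u.2.2.1 != l)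
      || (u.2.2.2 != i && u.2.2.2 != j && u.2.2.2 != k && u.2.2.2 != l)) = true) :
    ((c i j * c k l - c i k * c j l + c i l * c j k : ℤ) : ZMod 2) = 0 := by
  rw [List.all_eq_true] at hL
  have hL' : ∀ u ∈ L, (u.1 ≠ i ∧ u.1 ≠ j ∧ u.1 ≠ k ∧ u.1 ≠ l) ∨
      (u.2.1 ≠ i ∧ u.2.1 ≠ j ∧ u.2.1 ≠ k ∧ u.2.1 ≠ l) ∨ (u.2.2.1 ≠ i ∧ u.2.2.1 ≠ j ∧ u.2.2.1 ≠ k ∧ u.2.2.1 ≠ l) ∨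
      (u.2.2.2 ≠ i ∧ u.2.2.2 ≠ j ∧ u.2.2.2 ≠ k ∧ u.2.2.2 ≠ l) := by
    intro u hu
    have h := hL u hu
    simpa [Bool.or_eq_true, Bool.and_eq_true, bne_iff_ne, and_assoc, or_assoc] using h
  have hcount : L.count (i, j, k, l) = 0 := by
    rw [List.count_eq_zero]
    intro hm
    rcases hL' _ hm with ⟨h, -, -, -⟩ | ⟨-, h, -, -⟩ | ⟨-, -, h, -⟩ | ⟨-, -, -, h⟩ <;> exact h rfl
  rw [pfaffian_parity_of_sq_sum x c h0 hskew B W hB L hBB hij hik hil hjk hjl hkl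
    (fun u hu => Or.inr (hL' u hu)), hcount, Nat.cast_zero]

/-- Odd case of `pfaffian_parity_of_sq_sum`: `(i, j, k, l)` occurs once in `Ω` and every other 4-vector has a
coordinate outside. -/
theorem pfaffian_odd_of_sq_sum (x : Module.Basis n ℤ M) (c : n → n → ℤ) (h0 : ∀ a, c a a = 0)
    (hskew : ∀ a b, c b a = -c a b) (B W : ExteriorAlgebra ℤ M)
    (hB : B = ∑ a, ∑ b, if a < b then (c a b : ExteriorAlgebra ℤ M) * (ι ℤ (x a) * ι ℤ (x b)) else 0)
    (L : List (n × n × n × n))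
    (hBB : B * B = 2 * (L.map fun u => ι ℤ (x u.1) * ι ℤ (x u.2.1) * (ι ℤ (x u.2.2.1) * ι ℤ (x u.2.2.2))).sum
      + 4 * W)
    {i j k l : n} (hij : i ≠ j) (hik : i ≠ k) (hil : i ≠ l) (hjk : j ≠ k) (hjl : j ≠ l) (hkl : k ≠ l)
    (hnd : L.Nodup) (hmem : (i, j, k, l) ∈ L)
    (hL : (L.all fun u => u == (i, j, k, l) || (u.1 != i && u.1 != j && u.1 != k && u.1 != l)
      || (u.2.1 != i && u.2.1 != j && u.2.1 != k && u.2.1 != l) || (u.2.2.1 != i && u.2.2.1 != j && u.2.2.1 != k && u.2.2.1 != l)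
      || (u.2.2.2 != i && u.2.2.2 != j && u.2.2.2 != k && u.2.2.2 != l)) = true) :
    ((c i j * c k l - c i k * c j l + c i l * c j k : ℤ) : ZMod 2) = 1 := by
  rw [List.all_eq_true] at hL
  have hL' : ∀ u ∈ L, u = (i, j, k, l) ∨ ((u.1 ≠ i ∧ u.1 ≠ j ∧ u.1 ≠ k ∧ u.1 ≠ l) ∨
      (u.2.1 ≠ i ∧ u.2.1 ≠ j ∧ u.2.1 ≠ k ∧ u.2.1 ≠ l) ∨ (u.2.2.1 ≠ i ∧ u.2.2.1 ≠ j ∧ u.2.2.1 ≠ k ∧ u.2.2.1 ≠ l) ∨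
      (u.2.2.2 ≠ i ∧ u.2.2.2 ≠ j ∧ u.2.2.2 ≠ k ∧ u.2.2.2 ≠ l)) := by
    intro u hu
    have h := hL u hu
    simpa [Bool.or_eq_true, Bool.and_eq_true, bne_iff_ne, beq_iff_eq, and_assoc, or_assoc] using h
  rw [pfaffian_parity_of_sq_sum x c h0 hskew B W hB L hBB hij hik hil hjk hjl hkl hL',
    List.count_eq_one_of_mem hnd hmem, Nat.cast_one]

end Parity

section Lift

variable {M : Type*} [AddCommGroup M] [Module ℤ M] {n : Type*} [LinearOrder n] [Fintype n]

/-- **Congruent coefficient arrays give congruent 2-forms.**  If `c a b ≡ δ a b (mod 2)` for all `a < b` then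
`Σ_{a<b} c·ι x_a ι x_b = Σ_{a<b} δ·ι x_a ι x_b + 2·Z` with `Z` in the span of the 2-vectors. -/
theorem twoForm_congr_mod_two (x : n → M) (c δ : n → n → ℤ) (hc : ∀ a b, a < b → (2 : ℤ) ∣ c a b - δ a b) :
    ∃ Z ∈ Submodule.span ℤ (Set.range fun p : M × M => ι ℤ p.1 * ι ℤ p.2),
      (∑ a, ∑ b, if a < b then (c a b : ExteriorAlgebra ℤ M) * (ι ℤ (x a) * ι ℤ (x b)) else 0)
        = (∑ a, ∑ b, if a < b then (δ a b : ExteriorAlgebra ℤ M) * (ι ℤ (x a) * ι ℤ (x b)) else 0) + 2 * Z := by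
  have hc' : ∀ a b, ∃ d : ℤ, a < b → c a b = δ a b + 2 * d := by
    intro a b
    by_cases h : a < b
    · obtain ⟨d, hd⟩ := hc a b h
      exact ⟨d, fun _ => by linarith⟩
    · exact ⟨0, fun h' => absurd h' h⟩
  choose d hd using hc'
  refine ⟨∑ a, ∑ b, if a < b then (d a b : ExteriorAlgebra ℤ M) * (ι ℤ (x a) * ι ℤ (x b)) else 0, ?_, ?_⟩
  · refine Submodule.sum_mem _ fun a _ => Submodule.sum_mem _ fun b _ => ?_
    split_ifs
    · rw [← zsmul_eq_mul]
      exact Submodule.smul_mem _ _ (Submodule.subset_span ⟨(x a, x b), rfl⟩)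
    · exact Submodule.zero_mem _
  · rw [Finset.mul_sum, ← Finset.sum_add_distrib]
    refine Finset.sum_congr rfl fun a _ => ?_
    rw [Finset.mul_sum, ← Finset.sum_add_distrib]
    refine Finset.sum_congr rfl fun b _ => ?_
    split_ifs with h
    · rw [hd a b h, Int.cast_add, Int.cast_mul, Int.cast_ofNat, add_mul, mul_assoc]
    · simp

end Lift


end Summit.Ventures.HSemireg.CliqueDigitSupport
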